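import Summits.ValiantsHypothesis.ValiantsHypothesis.Theorems.LacunarySymmetroidMatrixDescartesCensusCUSoundNewton

/-!
# `MatrixDescartes` census — soundness of the chamber-uniform checker, part 4: arcs, transport balance, the certified magnitude bound

HONEST FRAMING.  Object-search cell `pub-symmetroid`; door-A item `DoorA26 = PosRootLawAt 2 6 19`
(stmt-ValiantsHypothesis-19979; OPEN, typed, never asserted).  The certificate layer of the soundness proof of `CU.checkChamber`
(`…CensusCUCheck`): an accepted transport ARC gives `Σ log Pᵢ ≤ m (log N + log r)` (AM–GM); an accepted BALANCE bounds the target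
pair-log sum by the arcs; `CU.boundConst_sound` (rows + Abel + transport ⇒ `D · Σ a_t ℓ_t ≤ log q`).  Competitors, domination and
the certificate recursion follow in `…CensusCUSoundDom`.  All relative to a `CU.Model` on a support `d` of the chamber.  Nothing here
bears on `V = 19`, on `DoorA26` itself (OPEN), on `MatrixDescartes` (stmt-ValiantsHypothesis-18050) or on `VP ≠ VNP`.

[folklore] Certificate-checker soundness; elementary.
-/

-- the D-0017 layout repeats a namespace component (single-conjunct summit); the `dupNamespace` linter flags it; name mandated.
set_option linter.dupNamespace false

namespace Summit.ValiantsHypothesis.ValiantsHypothesis.Theorems.LacunarySymmetroidMatrixDescartes.Census.CU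

open V20 (Atom Term PolySpec allAtoms posOf qA cA termNeg posTerms posl negAt fval Row RowSpec buildRow lprod pval tval sgnR
  Epos sums dist1 ordOK psum)
open Finset

variable {ord : List Atom} {s : Bool} {x : ℕ → ℝ} {v : Atom → ℝ} (d : Fin 6 → ℕ)

/-- The real value of the pair form of `p`. [folklore] -/
noncomputable def pf (ord : List Atom) (d : Fin 6 → ℕ) (p : ℕ × ℕ) : ℝ := ((pairForm ord p).ev d : ℝ)

/-! ## Pair forms are `≥ 1` on the chamber -/

/-- A valid pair `s < t < 21` has pair form `≥ 1` at every support of the chamber. [folklore] -/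
theorem one_le_pairForm {dl : List ℕ} (hordA : ordAtomsOK ord = true) (M : V20.Model dl ord s x v) (hdl : dl = dlist d)
    {p : ℕ × ℕ} (hp : p.1 < p.2 ∧ p.2 < 21) : 1 ≤ (pairForm ord p).ev d := by
  subst hdl
  rw [ev_pairForm, ← Epos_eq_ev d hordA hp.2, ← Epos_eq_ev d hordA (hp.1.trans hp.2)]
  have := V20.Epos_lt M.hord hp.1 hp.2
  omega

/-! ## Arcs -/

/-- Value of a sum of pair forms. [folklore] -/
theorem ev_pairSumForm (ord : List Atom) : ∀ P : List (ℕ × ℕ), ((pairSumForm ord P).ev d : ℝ) = (P.map (pf ord d)).sum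
  | [] => by simp [pairSumForm, ev_ld0]
  | p :: P => by rw [pairSumForm, ev_ldAdd]; push_cast; rw [ev_pairSumForm ord P]; simp [pf]

/-- **An accepted arc**: `Σ log Pᵢ ≤ m · (log N + log (rn/rd))`. [folklore] -/
theorem arcOK_sound {ctx : List LinD} {a : Arc} (h : arcOK ctx ord a = true) (hctx : ∀ G ∈ ctx, 0 ≤ G.ev d)
    (hpos : ∀ p : ℕ × ℕ, p.1 < p.2 ∧ p.2 < 21 → 1 ≤ (pairForm ord p).ev d) :
    (a.P.map fun p => Real.log (pf ord d p)).sum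
      ≤ a.P.length * (Real.log (pf ord d a.N) + Real.log ((a.rn : ℝ) / a.rd)) := by
  unfold arcOK at h
  simp only [Bool.and_eq_true, decide_eq_true_eq, List.all_eq_true] at h
  obtain ⟨⟨⟨⟨⟨⟨hne, hm4⟩, hP⟩, hN⟩, hrn⟩, hrd⟩, hfk⟩ := h
  have hPpos : ∀ p ∈ a.P, 1 ≤ pf ord d p := fun p hp => by
    have := hpos p (by simpa [pairOK] using hP p hp); unfold pf; exact_mod_cast this
  have hNpos : 1 ≤ pf ord d a.N := by have := hpos a.N (by simpa [pairOK] using hN); unfold pf; exact_mod_cast this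
  -- the linear premise
  have hlin := farkasOK_sound d hfk hctx
  rw [ev_ldSub, ev_ldSmul, ev_ldSmul] at hlin
  have hlinR : (a.rd : ℝ) * (a.P.map (pf ord d)).sum ≤ (a.P.length * a.rn : ℕ) * pf ord d a.N := by
    have := (Int.cast_le (R := ℝ)).2 hlin
    push_cast at this
    rw [ev_pairSumForm] at this
    have e : pf ord d a.N = ((pairForm ord a.N).ev d : ℝ) := rfl
    rw [e]; push_cast; linarith
  -- AM–GM
  set L : List ℝ := a.P.map (pf ord d) with hL
  have hLnn : ∀ y ∈ L, 0 ≤ y := fun y hy => by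
    rw [hL, List.mem_map] at hy; obtain ⟨p, hp, rfl⟩ := hy; linarith [hPpos p hp]
  have hLpos : ∀ y ∈ L, 0 < y := fun y hy => by
    rw [hL, List.mem_map] at hy; obtain ⟨p, hp, rfl⟩ := hy; linarith [hPpos p hp]
  have hlen : L.length = a.P.length := by simp [hL]
  have hm : 0 < a.P.length := List.length_pos_iff.2 hne
  have ham := V20.amgm_le_four L hLnn (by rw [hlen]; exact hm4)
  rw [hlen] at ham
  set m := a.P.length with hm'
  set r : ℝ := (a.rn : ℝ) / a.rd with hr
  have hrdR : (0 : ℝ) < a.rd := by exact_mod_cast hrd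
  have hrpos : 0 < r := by rw [hr]; positivity
  have hsum : L.sum ≤ m * (r * pf ord d a.N) := by
    rw [hr]
    have : L.sum ≤ (m * a.rn : ℕ) * pf ord d a.N / a.rd := by
      rw [le_div_iff₀ hrdR]; linarith
    calc L.sum ≤ (m * a.rn : ℕ) * pf ord d a.N / a.rd := this
      _ = m * ((a.rn : ℝ) / a.rd * pf ord d a.N) := by push_cast; ring
  have hprod : L.prod ≤ (r * pf ord d a.N) ^ m := by
    have h1 : (m : ℝ) ^ m * L.prod ≤ (m * (r * pf ord d a.N)) ^ m :=
      ham.trans (pow_le_pow_left₀ (List.sum_nonneg hLnn) hsum m)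
    rw [mul_pow] at h1
    exact le_of_mul_le_mul_left h1 (by positivity)
  have hLprod : 0 < L.prod := List.prod_pos hLpos
  have hlog := Real.log_le_log hLprod hprod
  rw [Real.log_pow, Real.log_mul hrpos.ne' (by linarith), Real.log_list_prod (fun y hy => (hLpos y hy).ne')] at hlog
  rw [hL, List.map_map] at hlog
  have : (a.P.map fun p => Real.log (pf ord d p)) = a.P.map (Real.log ∘ pf ord d) := rfl
  rw [this]
  linarith

/-! ## Form-weight bookkeeping of arcs and of the target -/

/-- The inner fold of an arc adds `z · Σ log P`. [folklore] -/
theorem fwSum_foldP (z : ℤ) : ∀ (P : List (ℕ × ℕ)) (acc : List (LinD × ℤ)),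
    fwSum d (P.foldl (fun w p => fwIns w (pairForm ord p) z) acc)
      = fwSum d acc + z * (P.map fun p => Real.log (pf ord d p)).sum
  | [], acc => by simp
  | p :: P, acc => by
    rw [List.foldl_cons, fwSum_foldP z P, fwSum_fwIns, List.map_cons, List.sum_cons]; unfold pf; ring

/-- The arc term `z · (Σ log P − m log N)`. [folklore] -/
noncomputable def arcVal (ord : List Atom) (d : Fin 6 → ℕ) (az : Arc × ℕ) : ℝ :=
  (az.2 : ℝ) * ((az.1.P.map fun p => Real.log (pf ord d p)).sum - az.1.P.length * Real.log (pf ord d az.1.N))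

/-- `arcWeightsF` adds the arc term. [folklore] -/
theorem fwSum_arcWeightsF (acc : List (LinD × ℤ)) (a : Arc) (z : ℕ) :
    fwSum d (arcWeightsF ord acc a z) = fwSum d acc + arcVal ord d (a, z) := by
  rw [arcWeightsF, fwSum_fwIns, fwSum_foldP, arcVal]
  unfold pf; push_cast; ring

/-- `arcsWeightsF` sums the arc terms. [folklore] -/
theorem fwSum_arcsWeightsF_aux : ∀ (arcs : List (Arc × ℕ)) (acc : List (LinD × ℤ)),
    fwSum d (arcs.foldl (fun acc az => arcWeightsF ord acc az.1 az.2) acc) = fwSum d acc + (arcs.map (arcVal ord d)).sum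
  | [], acc => by simp
  | az :: arcs, acc => by
    rw [List.foldl_cons, fwSum_arcsWeightsF_aux arcs, fwSum_arcWeightsF, List.map_cons, List.sum_cons]; ring

/-- `arcsWeightsF` sums the arc terms. [folklore] -/
theorem fwSum_arcsWeightsF (arcs : List (Arc × ℕ)) :
    fwSum d (arcsWeightsF ord arcs) = (arcs.map (arcVal ord d)).sum := by
  rw [arcsWeightsF, fwSum_arcsWeightsF_aux]; simp [fwSum]

/-- The inner fold of `subTarget`. [folklore] -/
theorem fwSum_subInner (b : List ℤ) (t : ℕ) : ∀ (n : ℕ) (acc : List (LinD × ℤ)),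
    fwSum d ((List.range n).foldl (fun w' u => fwIns w' (pairForm ord (u, t)) (b.getD u 0 + b.getD t 0)) acc)
      = fwSum d acc + ∑ u ∈ range n, ((b.getD u 0 : ℝ) + b.getD t 0) * Real.log (pf ord d (u, t))
  | 0, acc => by simp
  | n + 1, acc => by
    rw [List.range_succ, List.foldl_append, List.foldl_cons, List.foldl_nil, fwSum_fwIns, fwSum_subInner b t n,
      sum_range_succ]
    unfold pf; push_cast; ring

/-- `subTarget` subtracts the target pair weights. [folklore] -/
theorem fwSum_subTarget_aux (b : List ℤ) : ∀ (n : ℕ) (acc : List (LinD × ℤ)),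
    fwSum d ((List.range n).foldl (fun w t => (List.range t).foldl
        (fun w' u => fwIns w' (pairForm ord (u, t)) (b.getD u 0 + b.getD t 0)) w) acc)
      = fwSum d acc + ∑ t ∈ range n, ∑ u ∈ range t, ((b.getD u 0 : ℝ) + b.getD t 0) * Real.log (pf ord d (u, t))
  | 0, acc => by simp
  | n + 1, acc => by
    rw [List.range_succ, List.foldl_append, List.foldl_cons, List.foldl_nil, fwSum_subInner, fwSum_subTarget_aux b n,
      sum_range_succ]
    ring

/-- `subTarget` subtracts the target pair weights. [folklore] -/
theorem fwSum_subTarget (b : List ℤ) (acc : List (LinD × ℤ)) :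
    fwSum d (subTarget ord b acc)
      = fwSum d acc + ∑ t ∈ range 21, ∑ u ∈ range t, ((b.getD u 0 : ℝ) + b.getD t 0) * Real.log (pf ord d (u, t)) := by
  rw [subTarget, fwSum_subTarget_aux]

/-! ## Keys stay valid pair forms -/

/-- A key predicate preserved by the bookkeeping: here, "the form is `≥ 1` at `d`". [folklore] -/
def KeysGood (L : List (LinD × ℤ)) : Prop := ∀ e ∈ L, 1 ≤ e.1.ev d

/-- `fwIns` with a good key keeps keys good. [folklore] -/
theorem keysGood_fwIns {L : List (LinD × ℤ)} (hL : KeysGood d L) {F : LinD} (hF : 1 ≤ F.ev d) (z : ℤ) :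
    KeysGood d (fwIns L F z) := by
  intro e he
  rcases mem_fwIns L F z e he with h | ⟨e', he', hee'⟩
  · rw [h]; exact hF
  · rw [← hee']; exact hL e' he'

/-- The inner arc fold keeps keys good. [folklore] -/
theorem keysGood_foldP (hpos : ∀ p : ℕ × ℕ, p.1 < p.2 ∧ p.2 < 21 → 1 ≤ (pairForm ord p).ev d) (z : ℤ) :
    ∀ (P : List (ℕ × ℕ)), (∀ p ∈ P, pairOK p = true) → ∀ (acc : List (LinD × ℤ)), KeysGood d acc →
      KeysGood d (P.foldl (fun w p => fwIns w (pairForm ord p) z) acc)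
  | [], _, acc, hacc => by simpa
  | p :: P, hP, acc, hacc => by
    rw [List.foldl_cons]
    refine keysGood_foldP hpos z P (fun q hq => hP q (by simp [hq])) _ (keysGood_fwIns d hacc ?_ z)
    exact hpos p (by simpa [pairOK] using hP p (by simp))

/-- `arcsWeightsF` of checked arcs has good keys. [folklore] -/
theorem keysGood_arcs {ctx : List LinD} (hpos : ∀ p : ℕ × ℕ, p.1 < p.2 ∧ p.2 < 21 → 1 ≤ (pairForm ord p).ev d) :
    ∀ (arcs : List (Arc × ℕ)), (∀ az ∈ arcs, arcOK ctx ord az.1 = true) → ∀ (acc : List (LinD × ℤ)), KeysGood d acc →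
      KeysGood d (arcs.foldl (fun acc az => arcWeightsF ord acc az.1 az.2) acc)
  | [], _, acc, hacc => by simpa
  | az :: arcs, harcs, acc, hacc => by
    rw [List.foldl_cons]
    refine keysGood_arcs hpos arcs (fun b hb => harcs b (by simp [hb])) _ ?_
    have h := harcs az (by simp)
    unfold arcOK at h
    simp only [Bool.and_eq_true, decide_eq_true_eq, List.all_eq_true] at h
    obtain ⟨⟨⟨⟨⟨-, hP⟩, hN⟩, -⟩, -⟩, -⟩ := h
    rw [arcWeightsF]
    refine keysGood_fwIns d (keysGood_foldP d hpos _ _ hP _ hacc) ?_ _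
    exact hpos az.1.N (by simpa [pairOK] using hN)

/-- The inner target fold keeps keys good. [folklore] -/
theorem keysGood_subInner (hpos : ∀ p : ℕ × ℕ, p.1 < p.2 ∧ p.2 < 21 → 1 ≤ (pairForm ord p).ev d) (b : List ℤ)
    {t : ℕ} (ht : t < 21) : ∀ (n : ℕ), n ≤ t → ∀ (acc : List (LinD × ℤ)), KeysGood d acc →
      KeysGood d ((List.range n).foldl (fun w' u => fwIns w' (pairForm ord (u, t)) (b.getD u 0 + b.getD t 0)) acc)
  | 0, _, acc, hacc => by simpa
  | n + 1, hn, acc, hacc => by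
    rw [List.range_succ, List.foldl_append, List.foldl_cons, List.foldl_nil]
    exact keysGood_fwIns d (keysGood_subInner hpos b ht n (by omega) acc hacc) (hpos (n, t) ⟨by simp; omega, ht⟩) _

/-- `subTarget` keeps keys good. [folklore] -/
theorem keysGood_subTarget_aux (hpos : ∀ p : ℕ × ℕ, p.1 < p.2 ∧ p.2 < 21 → 1 ≤ (pairForm ord p).ev d) (b : List ℤ) :
    ∀ (n : ℕ), n ≤ 21 → ∀ (acc : List (LinD × ℤ)), KeysGood d acc →
      KeysGood d ((List.range n).foldl (fun w t => (List.range t).foldl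
        (fun w' u => fwIns w' (pairForm ord (u, t)) (b.getD u 0 + b.getD t 0)) w) acc)
  | 0, _, acc, hacc => by simpa
  | n + 1, hn, acc, hacc => by
    rw [List.range_succ, List.foldl_append, List.foldl_cons, List.foldl_nil]
    exact keysGood_subInner d hpos b (by omega) n le_rfl _ (keysGood_subTarget_aux hpos b n (by omega) acc hacc)

/-- **An accepted balance**: the target pair-log sum is bounded by the arc terms. [folklore] -/
theorem balanceOK_sound {ctx : List LinD} {b : List ℤ} {arcs : List (Arc × ℕ)} (h : balanceOK ord b arcs = true)
    (harcs : ∀ az ∈ arcs, arcOK ctx ord az.1 = true)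
    (hpos : ∀ p : ℕ × ℕ, p.1 < p.2 ∧ p.2 < 21 → 1 ≤ (pairForm ord p).ev d) :
    ∑ t ∈ range 21, ∑ u ∈ range t, -((b.getD u 0 : ℝ) + b.getD t 0) * Real.log (pf ord d (u, t))
      ≤ (arcs.map (arcVal ord d)).sum := by
  unfold balanceOK at h
  simp only [List.all_eq_true, decide_eq_true_eq] at h
  have hgood : KeysGood d (subTarget ord b (arcsWeightsF ord arcs)) := by
    rw [subTarget]
    refine keysGood_subTarget_aux d hpos b 21 le_rfl _ ?_
    rw [arcsWeightsF]
    exact keysGood_arcs d hpos arcs harcs [] (by intro e he; simp at he)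
  have hnn := fwSum_nonneg d h hgood
  rw [fwSum_subTarget, fwSum_arcsWeightsF] at hnn
  have : ∑ t ∈ range 21, ∑ u ∈ range t, -((b.getD u 0 : ℝ) + b.getD t 0) * Real.log (pf ord d (u, t))
      = -∑ t ∈ range 21, ∑ u ∈ range t, ((b.getD u 0 : ℝ) + b.getD t 0) * Real.log (pf ord d (u, t)) := by
    rw [← sum_neg_distrib]; refine sum_congr rfl fun t _ => ?_
    rw [← sum_neg_distrib]; exact sum_congr rfl fun u _ => by ring
  rw [this]; linarith

/-- The arc terms are bounded by `log ∏ (rn/rd)^{m z}`. [folklore] -/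
theorem arcs_le_const {ctx : List LinD} (hctx : ∀ G ∈ ctx, 0 ≤ G.ev d)
    (hpos : ∀ p : ℕ × ℕ, p.1 < p.2 ∧ p.2 < 21 → 1 ≤ (pairForm ord p).ev d) :
    ∀ (arcs : List (Arc × ℕ)), (∀ az ∈ arcs, arcOK ctx ord az.1 = true) →
      (arcs.map (arcVal ord d)).sum ≤ Real.log (arcsConst arcs : ℝ) ∧ 0 < arcsConst arcs
  | [], _ => by simp [arcsConst]
  | (a, z) :: arcs, h => by
    obtain ⟨ih1, ih2⟩ := arcs_le_const hctx hpos arcs (fun b hb => h b (by simp [hb]))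
    have ha := h (a, z) (by simp)
    have hb := arcOK_sound d ha hctx hpos
    have ha' := ha
    unfold arcOK at ha'
    simp only [Bool.and_eq_true, decide_eq_true_eq, List.all_eq_true] at ha'
    obtain ⟨⟨⟨⟨⟨-, -⟩, -⟩, hrn⟩, hrd⟩, -⟩ := ha'
    have hr : (0 : ℚ) < (a.rn : ℚ) / a.rd := by positivity
    refine ⟨?_, by rw [arcsConst]; positivity⟩
    rw [List.map_cons, List.sum_cons, arcsConst]
    push_cast
    rw [Real.log_mul (by positivity) (by exact_mod_cast ih2.ne'), Real.log_pow]
    have hz : (0 : ℝ) ≤ z := by positivity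
    have h1 : arcVal ord d (a, z) ≤ z * (a.P.length * Real.log ((a.rn : ℝ) / a.rd)) := by
      unfold arcVal
      simp only
      have := mul_le_mul_of_nonneg_left hb hz
      nlinarith
    push_cast
    nlinarith

/-! ## The certified magnitude bound -/

/-- **Soundness of `boundConst`**: `D · Σ_t a_t ℓ_t ≤ log q` and `q > 0`. [folklore] -/
theorem boundConst_sound (hordA : ordAtomsOK ord = true) (M : Model (dlist d) ord s x v)
    {ctx : List LinD} (hctx : ∀ G ∈ ctx, 0 ≤ G.ev d) {ctxL : List LRow} (hctxL : ∀ r ∈ ctxL, r.Holds (ell x) ∧ r.WF)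
    {a : List ℤ} (ha : a.length = 21) {D : ℕ} {rows : List (LSpec × ℕ)} {abel : List Fk} {arcs : List (Arc × ℕ)} {q : ℚ}
    (h : boundConst ctx ctxL ord s a D rows abel arcs = some q) :
    (D : ℝ) * vdot a (ell x) ≤ Real.log (q : ℝ) ∧ 0 < q := by
  unfold boundConst at h
  split at h
  · simp at h
  · next rs hrs =>
    dsimp only at h
    split_ifs at h with hc
    simp only [Option.some.injEq] at h
    subst h
    simp only [Bool.and_eq_true, List.all_eq_true] at hc
    obtain ⟨⟨⟨-, habel⟩, harcs⟩, hbal⟩ := hc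
    have hrows := buildLRows_sound M hctxL hrs
    obtain ⟨hrw, hrlen, hrpos⟩ := rowsWeight_le hrows
    have hpos : ∀ p : ℕ × ℕ, p.1 < p.2 ∧ p.2 < 21 → 1 ≤ (pairForm ord p).ev d :=
      fun p hp => one_le_pairForm d hordA M.toV20 rfl hp
    obtain ⟨hblen, hbsum, hbC, hbC20⟩ := abelOK_sound d habel hctx
    have hvp := vdot_le_pairs d hordA M.toV20 hblen hbsum hbC hbC20
    have hbalb := balanceOK_sound d hbal harcs hpos
    obtain ⟨harc1, harc2⟩ := arcs_le_const d hctx hpos arcs harcs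
    -- `vdot b = D · vdot a − vdot rowsWeight`
    have hlen2 : (vSmul (D : ℤ) a).length = (vSmul (-1) (rowsWeight rs)).length := by
      rw [length_vSmul, length_vSmul, ha, hrlen]
    have hvb : vdot (vAdd (vSmul (D : ℤ) a) (vSmul (-1) (rowsWeight rs))) (ell x)
        = (D : ℝ) * vdot a (ell x) - vdot (rowsWeight rs) (ell x) := by
      rw [vdot_vAdd _ hlen2, vdot_vSmul, vdot_vSmul]; push_cast; ring
    refine ⟨?_, by positivity⟩
    push_cast
    rw [Real.log_mul (by exact_mod_cast hrpos.ne') (by exact_mod_cast harc2.ne')]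
    have hpf : ∑ t ∈ range 21, ∑ u ∈ range t,
        -(((vAdd (vSmul (D : ℤ) a) (vSmul (-1) (rowsWeight rs))).getD u 0 : ℝ) +
          (vAdd (vSmul (D : ℤ) a) (vSmul (-1) (rowsWeight rs))).getD t 0) * Real.log ((pairForm ord (u, t)).ev d : ℝ)
        = ∑ t ∈ range 21, ∑ u ∈ range t,
        -(((vAdd (vSmul (D : ℤ) a) (vSmul (-1) (rowsWeight rs))).getD u 0 : ℝ) +
          (vAdd (vSmul (D : ℤ) a) (vSmul (-1) (rowsWeight rs))).getD t 0) * Real.log (pf ord d (u, t)) := rfl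
    rw [hpf] at hvp
    linarith

end Summit.ValiantsHypothesis.ValiantsHypothesis.Theorems.LacunarySymmetroidMatrixDescartes.Census.CU
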